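import Summits.Ventures.PercRepro.S1CoreCapSevenFour
import Summits.Ventures.PercRepro.S1CoreCapSevenOne
import Summits.Ventures.PercRepro.S1CoreCapSevenZero
import Summits.Ventures.PercRepro.S1CoreCapSevenTwo

/-!
# PercRepro — THE INSTANCE `ν = 7` OF THE 4-CIRCUIT-CAP SPEC MODULO TWO NON-PLANAR CASES (p1, gen 26)

The assembly of `Q*(7) = 19` by the number `n_big` of lines of `≥ 4` points: `n_big ≥ 4` is impossible
(`Seven.not_four_big`, the plane clause), `n_big = 1` (`sum_cap_le_nineteen_of_one_big`) and `n_big = 0`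
(`sum_cap_le_nineteen_of_no_big`) are theorems, and so are `n_big = 3` when the three lie in a plane
(`lineRank [L₃, L₂, L₁] ≤ 3`, `sum_cap_le_nineteen_of_three_big_plane`) and `n_big = 2` when the two lie in a
plane (`sum_cap_le_nineteen_of_two_big_plane`; always when they meet). WHAT IS OPEN is stated as two propositions
in the spec's own words — `ThreeBigNonplanarBound` (three big lines with `3 < lineRank [L₃, L₂, L₁]`, i.e. the
concurrent / path / one-pair / disjoint shapes) and `TwoBigNoncoplanarBound` (two disjoint big lines in no common
list of rank `≤ 3`) — and `fourCapSpec_seven_of` proves `FourCapSpec capPaper 7 19` from them: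
`sum_cap_le_nineteen_of` is the case split. The searches' maxima in the open cases are `17` (three simple 4-lines
not in a plane; `21` without the plane clause) and below `19`. `proofs/P1-S4-CAPBRIDGE.md` §18.
Axioms: standard (the two propositions are hypotheses, not axioms).
-/

namespace PercRepro

namespace S1

namespace FourCap

namespace Seven

/-- **OPEN CASE A** (stated): at nullity `7`, a configuration with exactly three lines of `≥ 4` points NOT in a
plane — `3 < lineRank [L₃, L₂, L₁]` — has cap sum `≤ 19`. -/
def ThreeBigNonplanarBound : Prop :=
  ∀ (β : Type) [DecidableEq β] (w : β → ℕ) (ls : Finset (Finset β)),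
    (∀ L ∈ ls, ∀ v ∈ L, w v = 1 ∨ w v = 2) →
    (∀ L ∈ ls, 3 ≤ L.card ∧ wsum w L ≤ 5) →
    (∀ L ∈ ls, ∀ L' ∈ ls, L ≠ L' → (L ∩ L').card ≤ 1) →
    (∀ l : List (Finset β), l.Nodup → (∀ L ∈ l, L ∈ ls) → wsum w (unionL l) ≤ 7 + lineRank l) →
    (∀ l : List (Finset β), l.Nodup → (∀ L ∈ l, L ∈ ls) → lineRank l ≤ 3 → (unionL l).card ≤ 9) →
    (∀ l : List (Finset β), l.Nodup → (∀ L ∈ l, L ∈ ls) → lineRank l ≤ 4 → (unionL l).card ≤ 20) →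
    ∀ L₁ L₂ L₃ : Finset β, L₁ ∈ ls → L₂ ∈ ls → L₃ ∈ ls → L₂ ≠ L₁ → L₃ ≠ L₁ → L₃ ≠ L₂ →
      4 ≤ L₁.card → 4 ≤ L₂.card → 4 ≤ L₃.card →
      (∀ L ∈ ls, L ≠ L₁ → L ≠ L₂ → L ≠ L₃ → L.card = 3) → 3 < lineRank [L₃, L₂, L₁] →
      ∑ L ∈ ls, capPaper L.card (fat w L) ≤ 19

/-- **OPEN CASE B** (stated): at nullity `7`, a configuration with exactly two lines of `≥ 4` points in NO common
duplicate-free list of `lineRank ≤ 3` (they are then disjoint) has cap sum `≤ 19`. -/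
def TwoBigNoncoplanarBound : Prop :=
  ∀ (β : Type) [DecidableEq β] (w : β → ℕ) (ls : Finset (Finset β)),
    (∀ L ∈ ls, ∀ v ∈ L, w v = 1 ∨ w v = 2) →
    (∀ L ∈ ls, 3 ≤ L.card ∧ wsum w L ≤ 5) →
    (∀ L ∈ ls, ∀ L' ∈ ls, L ≠ L' → (L ∩ L').card ≤ 1) →
    (∀ l : List (Finset β), l.Nodup → (∀ L ∈ l, L ∈ ls) → wsum w (unionL l) ≤ 7 + lineRank l) →
    (∀ l : List (Finset β), l.Nodup → (∀ L ∈ l, L ∈ ls) → lineRank l ≤ 3 → (unionL l).card ≤ 9) →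
    (∀ l : List (Finset β), l.Nodup → (∀ L ∈ l, L ∈ ls) → lineRank l ≤ 4 → (unionL l).card ≤ 20) →
    ∀ L₁ L₂ : Finset β, L₁ ∈ ls → L₂ ∈ ls → L₂ ≠ L₁ → 4 ≤ L₁.card → 4 ≤ L₂.card →
      (∀ L ∈ ls, L ≠ L₁ → L ≠ L₂ → L.card = 3) →
      (¬ ∃ l : List (Finset β), l.Nodup ∧ (∀ L ∈ l, L ∈ ls) ∧ lineRank l ≤ 3 ∧ L₁ ∈ l ∧ L₂ ∈ l) →
      ∑ L ∈ ls, capPaper L.card (fat w L) ≤ 19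

variable {β : Type} [DecidableEq β]

section SevenCases

variable {w : β → ℕ} {ls : Finset (Finset β)}
  (h1 : ∀ L ∈ ls, ∀ v ∈ L, w v = 1 ∨ w v = 2)
  (h2 : ∀ L ∈ ls, 3 ≤ L.card ∧ wsum w L ≤ 5)
  (h3 : ∀ L ∈ ls, ∀ L' ∈ ls, L ≠ L' → (L ∩ L').card ≤ 1)
  (h4 : ∀ l : List (Finset β), l.Nodup → (∀ L ∈ l, L ∈ ls) → wsum w (unionL l) ≤ 7 + lineRank l)
  (h5 : ∀ l : List (Finset β), l.Nodup → (∀ L ∈ l, L ∈ ls) → lineRank l ≤ 3 → (unionL l).card ≤ 9)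
  (h6 : ∀ l : List (Finset β), l.Nodup → (∀ L ∈ l, L ∈ ls) → lineRank l ≤ 4 → (unionL l).card ≤ 20)

include h1 h2 h3 h4 h5 h6 in
/-- **Every configuration of the spec at nullity `7` has cap sum `≤ 19`, modulo the two open cases**, by the
number of lines of `≥ 4` points. -/
theorem sum_cap_le_nineteen_of (hA : ThreeBigNonplanarBound) (hB : TwoBigNoncoplanarBound) :
    ∑ L ∈ ls, capPaper L.card (fat w L) ≤ 19 := by
  set F := ls.filter (fun L => 4 ≤ L.card) with hF
  have hFmem : ∀ L ∈ F, L ∈ ls ∧ 4 ≤ L.card := fun L hL => Finset.mem_filter.1 hL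
  have hcard3 : ∀ L ∈ ls, L ∉ F → L.card = 3 := by
    intro L hL hLF
    have := (h2 L hL).1
    by_contra hne
    exact hLF (Finset.mem_filter.2 ⟨hL, by omega⟩)
  rcases (by omega : F.card = 0 ∨ F.card = 1 ∨ F.card = 2 ∨ F.card = 3 ∨ 3 < F.card)
    with h0 | hone | htwo | hthree | hfour
  · -- no big line
    refine sum_cap_le_nineteen_of_no_big h1 h2 h3 h4 h5 (fun L hL => hcard3 L hL ?_)
    rw [Finset.card_eq_zero.1 h0]
    exact Finset.notMem_empty L
  · -- one big line
    obtain ⟨A, hA'⟩ := Finset.card_eq_one.1 hone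
    have hAF : A ∈ F := hA' ▸ Finset.mem_singleton_self A
    exact sum_cap_le_nineteen_of_one_big h1 h2 h3 h4 (hFmem A hAF).1 (hFmem A hAF).2
      (fun L hL hne => hcard3 L hL (by rw [hA']; exact fun h => hne (Finset.mem_singleton.1 h)))
  · -- two big lines
    obtain ⟨A, B, hne, hF2⟩ := Finset.card_eq_two.1 htwo
    have hAF : A ∈ F := hF2 ▸ Finset.mem_insert_self A {B}
    have hBF : B ∈ F := hF2 ▸ Finset.mem_insert_of_mem (Finset.mem_singleton_self B)
    obtain ⟨hA', cA⟩ := hFmem A hAF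
    obtain ⟨hB', cB⟩ := hFmem B hBF
    have hrest : ∀ L ∈ ls, L ≠ A → L ≠ B → L.card = 3 := fun L hL hLA hLB => hcard3 L hL (by
      rw [hF2]
      simp [hLA, hLB])
    by_cases hcop : ∃ l : List (Finset β), l.Nodup ∧ (∀ L ∈ l, L ∈ ls) ∧ lineRank l ≤ 3 ∧ A ∈ l ∧ B ∈ l
    · obtain ⟨l, hnd, hls, hr, hAl, hBl⟩ := hcop
      exact sum_cap_le_nineteen_of_two_big_plane h1 h2 h3 h4 h5 hA' hB' hne.symm cA cB hrest hnd hls hr hAl hBl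
    · exact hB β w ls h1 h2 h3 h4 h5 h6 A B hA' hB' hne.symm cA cB hrest hcop
  · -- three big lines
    obtain ⟨L₁, L₂, L₃, h12, h13, h23, hF3⟩ := Finset.card_eq_three.1 hthree
    have hL₁F : L₁ ∈ F := hF3 ▸ Finset.mem_insert_self L₁ {L₂, L₃}
    have hL₂F : L₂ ∈ F := hF3 ▸ Finset.mem_insert_of_mem (Finset.mem_insert_self L₂ {L₃})
    have hL₃F : L₃ ∈ F := hF3 ▸ Finset.mem_insert_of_mem (Finset.mem_insert_of_mem (Finset.mem_singleton_self L₃))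
    have hrest : ∀ L ∈ ls, L ≠ L₁ → L ≠ L₂ → L ≠ L₃ → L.card = 3 := fun L hL hL1 hL2 hL3 => hcard3 L hL (by
      rw [hF3]
      simp [hL1, hL2, hL3])
    by_cases hr : lineRank [L₃, L₂, L₁] ≤ 3
    · exact sum_cap_le_nineteen_of_three_big_plane h1 h2 h3 h4 h5 (hFmem L₁ hL₁F).1 (hFmem L₂ hL₂F).1
        (hFmem L₃ hL₃F).1 h12.symm h13.symm h23.symm (hFmem L₁ hL₁F).2 (hFmem L₂ hL₂F).2 (hFmem L₃ hL₃F).2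
        hrest hr
    · exact hA β w ls h1 h2 h3 h4 h5 h6 L₁ L₂ L₃ (hFmem L₁ hL₁F).1 (hFmem L₂ hL₂F).1 (hFmem L₃ hL₃F).1
        h12.symm h13.symm h23.symm (hFmem L₁ hL₁F).2 (hFmem L₂ hL₂F).2 (hFmem L₃ hL₃F).2 hrest
        (by omega)
  · -- four big lines: impossible
    exfalso
    obtain ⟨L₁, hL₁, L₂, hL₂, L₃, hL₃, h12, h13, h23⟩ := Finset.two_lt_card.1 (by omega : 2 < F.card)
    obtain ⟨L₄, hL₄, hL₄'⟩ : ∃ L₄ ∈ F, L₄ ∉ ({L₁, L₂, L₃} : Finset (Finset β)) := by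
      by_contra hc
      have hsub : F ⊆ {L₁, L₂, L₃} := fun L hL => by
        by_contra h
        exact hc ⟨L, hL, h⟩
      have := Finset.card_le_card hsub
      rw [Finset.card_insert_of_notMem (by simp [h12, h13]), Finset.card_pair h23] at this
      omega
    simp only [Finset.mem_insert, Finset.mem_singleton, not_or] at hL₄'
    exact not_four_big h1 h2 h3 h4 h5 (hFmem L₁ hL₁).1 (hFmem L₂ hL₂).1 (hFmem L₃ hL₃).1 (hFmem L₄ hL₄).1
      h12.symm h13.symm hL₄'.1 h23.symm hL₄'.2.1 hL₄'.2.2 (hFmem L₁ hL₁).2 (hFmem L₂ hL₂).2 (hFmem L₃ hL₃).2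
      (hFmem L₄ hL₄).2

end SevenCases

/-- **THE INSTANCE `ν = 7` MODULO THE TWO OPEN CASES**: `FourCapSpec capPaper 7 19` follows from
`ThreeBigNonplanarBound` and `TwoBigNoncoplanarBound`. -/
theorem fourCapSpec_seven_of (hA : ThreeBigNonplanarBound) (hB : TwoBigNoncoplanarBound) :
    FourCapSpec capPaper 7 19 := by
  intro β _ w ls h1 h2 h3 h4 h5 h6
  exact sum_cap_le_nineteen_of h1 h2 h3 h4 h5 h6 hA hB

end Seven

end FourCap

end S1

end PercRepro
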